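import Summits.KontsevichZagierPeriods.KontsevichZagierPeriods.Theses.PeriodConductors
import Summits.KontsevichZagierPeriods.KontsevichZagierPeriods.Theorems.LinRedNormalFormMzvKernelInKZScoping

/-!
# Crux `UnimodularKernel` (stmt-KontsevichZagierPeriods-8404) — birth skeleton (`Lines/birth.lean`, BC3)

Route `PeriodConductors`, rank-3 crux `UnimodularKernel` ("Conjecture 1 over Spec ℤ" on the
regular-matroid linear sector): every vanishing `ℤ`-combination of representations `[r]`, `r` over
an open rational linear cell `{ℓᵢ > 0}` with integrand `P(x)/∏ ℓᵢ(x)^{mᵢ}` (integral affine forms,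
one row the hyperplane at infinity) whose integer matrix has the same row-subset ranks over every
`𝔽_p` as over `ℚ` (everywhere-good = regular matroid data), lies in `KZ.relations`.

The route file names the intended split (TWO-LAYER PLAN: `UnimodularKernel ⇐ UnimodularToSimplex →
MZV-sector kernel`), and the tree already owns the MZV-sector kernel in SCOPED form (route
`LinRedNormalForm`, items #6/#7 ⇒ #4, Theorems-level twin
`LinRedNormalForm.MzvKernelInKZ.mzvKernelInKZ_of_hoffmanSpanInKZ`). The skeleton cuts the crux along
exactly these seams, one kind of mathematics per stub:

* `stub_regularCellNormalForm` (GEOMETRY INSIDE THE RULES — the crux-specific, load-bearing stub;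
  open, size XL): every everywhere-good linear-cell representation is congruent modulo
  `KZ.relations` to a `ℤ`-combination of MZV WORD representations `[Δ_w, q·∏ ω_ε]` (verbatim the
  generator set of `LinRedNormalForm.MzvKernelInKZ` / `HoffmanSpanInKZ`, so the chain closes by name).
  It EXTENDS `LinRedNormalForm.DihedralNormalForm` (stmt-3912: the braid arrangement `{tᵢ, 1 − tᵢ,
  tᵢ − tⱼ}`, a graphic = regular configuration) from the braid cells to ALL regular cells (graphic,
  cographic, sporadic `R₁₀`-type), which is precisely the new content of this crux relative to the
  genus-zero sector. Value-level shadow = the route's own crux #4 `UnimodularValuesAreMZV` (regular ⇒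
  bi-arrangement motive in `MT(ℤ)` ⇒ MZV: Dupont arXiv:1410.6348, Deligne–Goncharov
  arXiv:math/0302267, Brown arXiv:1102.1312). Calculus version demanded: Brown–Panzer unfolded
  hyperlogarithm reduction (arrangements are linearly reducible in every order) with letters kept in
  `{0, 1}` by unimodularity of all minors, and every intermediate absolutely convergent (paired
  counter-terms), as in the `DihedralNormalForm` programme.
* `stub_hoffmanSpanInKZ` = `LinRedNormalForm.HoffmanSpanInKZ` BY NAME (stmt-15044; RULES ≡ MOTIVES on
  the MZV sector: Brown's Hoffman decomposition of every MZV word is a chain of moves; open).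
* `stub_hoffmanIndependence` = `LinRedNormalForm.HoffmanIndependence` BY NAME (stmt-15045; the
  DECLARED TRANSCENDENCE INPUT: `ℚ`-linear independence of the real Hoffman values, Zagier-conjecture
  strength; not attacked).

Composition (`unimodularKernel_of_stubs`, a real proof): given `c ∈ closure (cell ∅)` with
`eval c = 0`, closure induction with stub A (`LinRedNormalForm.MzvKernelInKZ.exists_congr_of_mem_closure`)
gives `m` in the MZV-word subgroup with `c − m ∈ KZ.relations`; soundness
(`KZ.relations_le_ker_eval_holds`) gives `eval m = 0`; stubs B ∧ C give `MzvKernelInKZ`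
(`mzvKernelInKZ_of_hoffmanSpanInKZ`, landed), hence `m ∈ KZ.relations`, hence `c ∈ KZ.relations`.
The registered theorem `UnimodularKernel_of : UnimodularKernel` concludes the crux BY NAME through
the definitional read-back `unimodularKernel_iff` (`Iff.rfl`). `sorry` occurs ONLY inside the three
`stub_*` theorems.

Barriers (catalogue `Literature/Barriers/KontsevichZagierPeriods`): the strength barriers
`kzConjecture_implies_oddZetaAlgIndep` / `_twoPiI_log_algIndep` sit entirely in stub C (declared,
e.g. `zeta_five_ne_of_hoffmanIndependence`); `noSemialgebraicPrimitive_inv_sub_two` constrains stub A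
only in the known way (no in-class primitive elimination: hyperlogarithms stay UNFOLDED as extra
simplex variables — the evasion "add variables"); `cressonViuSos_prop_3_2` (semialgebraic
Hauptvermutung) is not engaged (no scissors congruence of bodies is claimed);
`_ellipticPeriods_algIndep` not engaged (mixed Tate only). Disproof used: none on record for this crux
(`ledger crux ls stmt-KontsevichZagierPeriods-8404`: no `Disproof.lean`); negatives index of the summit:
one entry (KinematicPlaneConvex, `K = ∅` witness), unrelated; the Negative lemmas landed for the
neighbouring items (`Theorems/HoffmanIndependence/Negative/*`: `…_false_without_noOnes`,
`…_false_letterFour`, `…_false_algebraic`) refute STRENGTHENINGS of stub C, which is used here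
verbatim by name, not strengthened.

BC3 probes (registrar folder `bc/UnimodularKernel_probes.lean`): for each stub `S`,
`S → UnimodularKernel` and `S → KontsevichZagierPeriods` by `first | exact? | simpa | aesop` FAIL.
-/

noncomputable section

set_option linter.dupNamespace false

open Literature.NumberTheory.Transcendental
open Summit.KontsevichZagierPeriods.KontsevichZagierPeriods.Theses.PeriodConductors (UnimodularKernel)
open Summit.KontsevichZagierPeriods.KontsevichZagierPeriods.Theses.LinRedNormalForm
  (MzvKernelInKZ HoffmanSpanInKZ HoffmanIndependence)
open Summit.KontsevichZagierPeriods.LinRedNormalForm.MzvKernelInKZ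
  (exists_congr_of_mem_closure mzvKernelInKZ_of_hoffmanSpanInKZ)

namespace Summit.KontsevichZagierPeriods.KontsevichZagierPeriods.Cruxes.UnimodularKernel.Birth

/-! ### Named vocabulary (literally the bodies of the crux's `let`s; read-back `unimodularKernel_iff` is `Iff.rfl`) -/

/-- The integral affine form of row `i` of `M` (column `0` = constant term = the hyperplane at
infinity): `ℓᵢ(x) = M i 0 + ∑ⱼ M i (j+1) · xⱼ` — the crux's `lin`. [folklore] -/
def lin (n k : ℕ) (M : Fin k → Fin (n + 1) → ℤ) (i : Fin k) (x : Fin n → ℝ) : ℝ :=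
  (M i 0 : ℝ) + ∑ j : Fin n, (M i j.succ : ℝ) * x j

/-- The integer matrices `M` whose matroid has good reduction at `p`: every set of rows has the same
rank over `𝔽_p` as over `ℚ` — membership `M ∈ regularAt n k p` is the crux's `good n k p M`
(definitionally). [folklore] -/
def regularAt (n k p : ℕ) : Set (Fin k → Fin (n + 1) → ℤ) :=
  {M | ∀ T : Finset (Fin k),
    (Matrix.of fun (i : T) (j : Fin (n + 1)) => (M i j : ZMod p)).rank =
      (Matrix.of fun (i : T) (j : Fin (n + 1)) => (M i j : ℚ)).rank}

/-- The generators of the sector with bad reduction inside `S`: representations over an open linear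
cell `{ℓᵢ > 0 (i with wᵢ)}` with integrand `P/∏ ℓᵢ^{mᵢ}`, one row the hyperplane at infinity, matroid
good at every prime outside `S` — the crux's `cell`. [folklore] -/
def cell (S : Finset ℕ) : Set KZ.FormalRep :=
  {x | ∃ (n k : ℕ) (M : Fin k → Fin (n + 1) → ℤ) (w : Fin k → Bool) (m : Fin k → ℕ)
      (P : MvPolynomial (Fin n) ℚ) (r : KZ.IntegralRep n),
    (∃ i, M i = Pi.single 0 1) ∧ (∀ p : ℕ, p.Prime → p ∉ S → M ∈ regularAt n k p) ∧
    r.domain = {x | ∀ i, w i = true → 0 < lin n k M i x} ∧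
    Set.EqOn r.integrand (fun x => MvPolynomial.aeval x P / ∏ i, lin n k M i x ^ m i) r.domain ∧
    x = KZ.of r}

/-- The MZV WORD generators `[Δ_w, q·∏ᵢ ω_{εᵢ}(tᵢ)]` on the open ordered simplex (`ω₀ = 1/t`,
`ω₁ = 1/(1−t)`, `q ∈ ℚ`; `w = 0` = the rational constants) — verbatim the generator set of
`LinRedNormalForm.MzvKernelInKZ` (read-back `mzvKernelInKZ_iff` is `Iff.rfl`). [folklore] -/
def mzvWordGen : Set KZ.FormalRep :=
  {x | ∃ (w : ℕ) (ε : Fin w → Bool) (q : ℚ) (s : KZ.IntegralRep w),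
    s.domain = {t | (∀ i, 0 < t i) ∧ (∀ i, t i < 1) ∧ StrictAnti t} ∧
    Set.EqOn s.integrand (fun t => (q : ℝ) * ∏ i, if ε i then 1 / (1 - t i) else 1 / t i) s.domain ∧
    x = KZ.of s}

/-- Read-back: the crux is the kernel statement on the subgroup generated by `cell ∅`
(definitional — certifies that `lin`/`regularAt`/`cell` are literally the crux's bodies). [folklore] -/
theorem unimodularKernel_iff :
    UnimodularKernel ↔ ∀ c ∈ AddSubgroup.closure (cell ∅), KZ.eval c = 0 → c ∈ KZ.relations :=
  Iff.rfl

/-- Read-back: `LinRedNormalForm.MzvKernelInKZ` is the kernel statement on the subgroup generated by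
`mzvWordGen` (definitional). [folklore] -/
theorem mzvKernelInKZ_iff :
    MzvKernelInKZ ↔ ∀ c ∈ AddSubgroup.closure mzvWordGen, KZ.eval c = 0 → c ∈ KZ.relations :=
  Iff.rfl

/-! ### Registered stubs (the only `sorry`s of this file) -/

/-- **STUB A — `regularCellNormalForm` (geometry inside the rules; the crux-specific stub; open,
size XL).** Every representation over an open rational linear cell with linear poles whose integer
matrix (hyperplane at infinity included) has good reduction at EVERY prime is congruent, modulo
`KZ.relations`, to a `ℤ`-combination of MZV word representations `[Δ_w, q·∏ ω_ε]`. Extends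
`LinRedNormalForm.DihedralNormalForm` (braid cells) to all regular cells; value shadow =
`PeriodConductors.UnimodularValuesAreMZV`. Intended engine: unfolded Brown–Panzer hyperlogarithm
reduction along a coordinate (arrangements are linearly reducible in every order; the letters
produced are ratios of minors, hence in `{0, 1, ∞}` for everywhere-good data), partial fractions =
rule (1b), cell dissections = rule (1a), unimodular coordinate changes = rule (2), the primitive step =
ONE Newton–Leibniz move (rule 3) with the hyperlogarithm kept unfolded as simplex variables, paired
convergent counter-terms at the corners. Why it might fail: a regular NON-graphic cell (cographic
`K₃,₃`, `R₁₀`) where no fibration order keeps every intermediate absolutely convergent with letters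
in `{0,1}`; or a regular cell with a certified non-MZV value (kills the value shadow first).
[KontsevichZagier2001 §1.2; Brown2009FeynmanPeriods (linear reducibility); Panzer2015 (HyperInt);
BrownENS2009 Thm 1.1; arXiv:1410.6348; arXiv:math/0302267; arXiv:1102.1312] -/
theorem stub_regularCellNormalForm :
    ∀ (n k : ℕ) (M : Fin k → Fin (n + 1) → ℤ) (w : Fin k → Bool) (m : Fin k → ℕ)
      (P : MvPolynomial (Fin n) ℚ) (r : KZ.IntegralRep n),
      (∃ i, M i = Pi.single 0 1) → (∀ p : ℕ, p.Prime → M ∈ regularAt n k p) →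
      r.domain = {x | ∀ i, w i = true → 0 < lin n k M i x} →
      Set.EqOn r.integrand (fun x => MvPolynomial.aeval x P / ∏ i, lin n k M i x ^ m i) r.domain →
      ∃ c ∈ AddSubgroup.closure mzvWordGen, KZ.of r - c ∈ KZ.relations := by
  sorry

/-- **STUB B — `hoffmanSpanInKZ` = route `LinRedNormalForm` item `HoffmanSpanInKZ`
(stmt-KontsevichZagierPeriods-15044) BY NAME (rules ≡ motives on the MZV sector; open).** Every MZV word
generator `[Δ_w, q·∏ ω_ε]` is congruent modulo `KZ.relations` to a `ℤ`-combination of HOFFMAN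
generators `[Δ_w, q'·ω_u]`, `u ∈ {2,3}^×` of the same weight — Brown's motivic decomposition
(arXiv:1102.1312 Thm 1.1/7.4) realised by chains of moves with convergent intermediates. Why it might
fail: rules may be weaker than motives (Huber–Müller-Stach 2017 Rem. 13.1.8) — a regularised
double-shuffle / associator relation with no absolutely convergent move chain.
[Brown2012 Thm 1.1/7.4 = arXiv:1102.1312; arXiv:1102.1310; HuberMullerStachPeriods2017 Rem 13.1.8;
KontsevichZagier2001 §1.2] -/
theorem stub_hoffmanSpanInKZ : HoffmanSpanInKZ := by
  sorry

/-- **STUB C — `hoffmanIndependence` = route `LinRedNormalForm` item `HoffmanIndependence`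
(stmt-KontsevichZagierPeriods-15045) BY NAME (the declared transcendence input; Zagier-conjecture
strength; not attacked from this line).** The real Hoffman values `ζ(u)`, `u ∈ {2,3}^×` (all weights,
`ζ(∅) = 1` included), are `ℚ`-linearly independent. Why it might fail: one `ℚ`-linear relation among
real Hoffman MZVs (none known or expected). Used verbatim — none of the refuted strengthenings of
`Theorems/HoffmanIndependence/Negative/*` (larger alphabets, algebraic independence) is assumed.
[Zagier1994 §9; Brown2012 Thm 1.1; IharaKanekoZagier2006; Hoffman1997] -/
theorem stub_hoffmanIndependence : HoffmanIndependence := by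
  sorry

/-! ### Composition (no `sorry` below this line) -/

/-- **Composition, hypotheses form (pure logic + soundness of the moves).** The three stub STATEMENTS
imply the kernel statement on the regular sector: move `c` into the MZV-word subgroup by stub A
extended additively, read `eval m = 0` off soundness, and apply the MZV kernel derived from stubs
B ∧ C by the landed scoping theorem `mzvKernelInKZ_of_hoffmanSpanInKZ`. Its conclusion is the crux
UNFOLDED (so that `UnimodularKernel_of` below is the unique theorem of this file concluding the crux
by name). [folklore] -/
theorem unimodularKernel_of_stubs
    (hA : ∀ (n k : ℕ) (M : Fin k → Fin (n + 1) → ℤ) (w : Fin k → Bool) (m : Fin k → ℕ)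
      (P : MvPolynomial (Fin n) ℚ) (r : KZ.IntegralRep n),
      (∃ i, M i = Pi.single 0 1) → (∀ p : ℕ, p.Prime → M ∈ regularAt n k p) →
      r.domain = {x | ∀ i, w i = true → 0 < lin n k M i x} →
      Set.EqOn r.integrand (fun x => MvPolynomial.aeval x P / ∏ i, lin n k M i x ^ m i) r.domain →
      ∃ c ∈ AddSubgroup.closure mzvWordGen, KZ.of r - c ∈ KZ.relations)
    (hB : HoffmanSpanInKZ) (hC : HoffmanIndependence) :
    ∀ c ∈ AddSubgroup.closure (cell ∅), KZ.eval c = 0 → c ∈ KZ.relations := by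
  -- the MZV-sector kernel, derived from B ∧ C (route LinRedNormalForm's scoping, landed)
  have hKER : ∀ c ∈ AddSubgroup.closure mzvWordGen, KZ.eval c = 0 → c ∈ KZ.relations :=
    mzvKernelInKZ_iff.mp (mzvKernelInKZ_of_hoffmanSpanInKZ hB hC)
  intro c hc hc0
  -- stub A extended additively along the closure: `c ≡ m (mod relations)`, `m` in the MZV-word subgroup
  obtain ⟨m, hm, hcm⟩ := exists_congr_of_mem_closure (T := mzvWordGen) hc (fun x hx => by
    obtain ⟨n, k, M, w, mult, P, r, hinf, hgood, hdom, hint, rfl⟩ := hx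
    exact hA n k M w mult P r hinf (fun p hp => hgood p hp (by simp)) hdom hint)
  -- soundness of the moves: `eval m = eval c = 0`
  have hm0 : KZ.eval m = 0 := by
    have h := (AddMonoidHom.mem_ker).1 (KZ.relations_le_ker_eval_holds hcm)
    rwa [map_sub, hc0, zero_sub, neg_eq_zero] at h
  -- the MZV kernel, then climb back along `c = (c - m) + m`
  have key := add_mem hcm (hKER m hm hm0)
  rwa [sub_add_cancel] at key

/-- **Skeleton theorem (registered form).** The crux `UnimodularKernel` BY NAME from the three
declared stubs, via the sorry-free composition `unimodularKernel_of_stubs` and the definitional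
read-back `unimodularKernel_iff`; `sorry` occurs only inside `stub_regularCellNormalForm`,
`stub_hoffmanSpanInKZ`, `stub_hoffmanIndependence`. [folklore] -/
theorem UnimodularKernel_of : UnimodularKernel :=
  unimodularKernel_iff.mpr
    (unimodularKernel_of_stubs stub_regularCellNormalForm stub_hoffmanSpanInKZ
      stub_hoffmanIndependence)

end Summit.KontsevichZagierPeriods.KontsevichZagierPeriods.Cruxes.UnimodularKernel.Birth

end
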